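import Literature.IUT.HodgeTheaters.BadLocalFrobenioidBases
import Literature.IUT.HodgeTheaters.GaloisValDatumOfComplete
import Literature.NumberTheory.LocalFields.EquivariantUnitRigidityNormed
import Literature.AnabelianGeometry.AbsoluteAnabelian.MLFGaloisModelPairs
import HarnessLib

/-!
# [IUTchI] Def 5.2 (v)/(vi), Cor 5.3 (ii) at `v̲ ∈ V̲^bad`: the MLF-Galois `TM`-pair `(Π_v̲ ↷ 𝒪^▷_{K̄_v̲})` of a bad-place group datum

S. Mochizuki, *Inter-universal Teichmüller theory I*, kurims manuscript (May 2020) [claim: Mochizuki2012, status: disputed]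
(D-0012 claim key; nothing of the series is asserted here; no side is taken on [IUTchIII] Cor. 3.12):
* Example 3.2 (i) p. 70 — at `v ∈ V^bad` the base `𝒟_v = ℬ^temp(X̲̲_v)⁰` with «a natural functor `𝒟_v → 𝒟⊢_v = ℬ(K_v)⁰`», i.e. the
  augmentation `Π_v ↠ G_v = Gal(K̄_v/K_v)` — in the tree abc-iut-L5-t2's `BadLocalGroupDatum G_v Π_v` (`aug` continuous, OPEN,
  surjective; `BadLocalFrobenioidBases.lean`) over abc-iut-L5-t16's valued Galois datum `GaloisValDatum.ofComplete p K_v` (`Ω = K̄_v` =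
  Mathlib's `AlgebraicClosure`, spectral norm; `GaloisValDatumOfComplete.lean`); Example 3.2 (iii) p. 71 («the `p_v`-adic Frobenioid
  constituted by the "base-field-theoretic hull" `𝒞_v`»);
* Definition 5.2 (v) p. 135 l. 43–49 («one may construct group-theoretically from `π₁(‡𝒟_v̲)` … an ind-topological monoid [which is
  naturally isomorphic to `𝒪^▷_{F̄_v̲}`] `𝕄_v(‡𝒟_v̲)` equipped with its natural `π₁(‡𝒟_v)`-action» [cf. [AbsTopIII], Corollary 1.10]) and
  (vi) p. 136 l. 4–17 («`π₁(‡𝒟_v) ↷ ‡𝕄_v` … isomorphic … to the pair `π₁(‡𝒟_v) ↷ 𝕄_v(‡𝒟_v̲)` … related to the Frobenioid `‡ℱ_v̲` via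
  the unique isomorphism corresponding to the identity automorphism of `‡𝔇` [cf. Corollary 5.3, (ii), below] … the `p_v̲`-adic
  Frobenioid determined … by the pair `π₁(‡𝒟_v̲) ↷ ‡𝕄_v`»; line numbers of the cell's render, `lit/IUTchI-DEF52-v-viii-VERBATIM.md`);
* Corollary 5.3 (ii) p. 144 («the natural map `Isom(¹𝔉, ²𝔉) → Isom(¹𝔇, ²𝔇)` is bijective»; proof l. 33–36 «follows immediately
  from [AbsTopIII], Proposition 3.2, (iv) …»).
S. Mochizuki, *Topics in absolute anabelian geometry III*, Def. 3.1 (i)/(ii) pp. 66–67 (model data `(k, k̄, ε_k : Π_k ↠ G_k)`, the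
model `TM`-pair `(Π_k ↷ 𝒪_k̄^▷)`, MLF-Galois `TM`-pairs) [cite: MochizukiAbsTopIII2015, Definition 3.1 (i)(ii) pp.66-67] — abc-iut-L4-t2's
`MLFClosure`, `ModelMLFGaloisData`, `ModelMLFGaloisData.tmPair`, `IsMLFGaloisMonoidPair` (`MLFGaloisModel.lean`, `MLFGaloisModelPairs.lean`).

WHAT THIS FILE DOES (cell abc-iut, seat abc-iut-w4-d109 gen 10, row «COR53II-BAD-SLOT-BYNAME@TMPAIR», lane 2 on token
IUTchI:Cor5.3(ii); sizing memo of abc-iut-L5-t5 gen 8 adopted by the L5 desk).  A DEF-LIGHT ADAPTER, nothing restated: the bad-place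
group datum `T : BadLocalGroupDatum Gal(K̄_v/K_v) Π_v` (any `K_v` complete, nonarchimedean, finite over `ℚ_p`; any topological group
`Π_v`) IS abc-iut-L4-t2's [AbsTopIII] Def. 3.1 (i) model data VERBATIM — `GaloisValDatum.closureOfComplete p K_v := (K_v, K̄_v)` as an
`MLFClosure` (local field structure of the norm, abc-iut-w4-d014's `isNonarchimedeanLocalField_of_finiteDimensional_padic`),
`T.modelData := ⟨Π_v, aug, continuous, surjective⟩`, and **`T.tmPair := T.modelData.tmPair = (Π_v ↷ 𝒪^▷_{K̄_v})`** — the MLF-Galois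
`TM`-pair of Def. 5.2 (v)/(vi) at a bad place, the carrier on which print's proof of Cor. 5.3 (ii) («[AbsTopIII], Proposition 3.2,
(iv)») operates.  Only definitional bookkeeping (`rfl`) is proved here; every theorem with content — the `.TM` binder of F-0174 / F-0409
(`IsMLFGaloisMonoidPair .TM T.tmPair`, by abc-iut-L4-t2's `isMLFGaloisMonoidPair_tmPair`), the arithmetic kernel `T.tmPair.actionKer =
Ker(aug)` (abc-iut-L6's `ModelMLFGaloisData.tmPair_actionKer`), open augmentation of every `TM`-model of the pair, and the by-name discharge
of the two bad-slot laws of Cor. 5.3 (ii) at this pair (hker ⟸ F-0174 `PairIsoDeterminedByGalois`, hlift ⟸ F-0409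
`GaloisIsoLiftsToTMPairIso` at open augmentation — both PROVED rows of abc-iut-L4) — is the proof-only sequel `Cor53iiAtBadPlaceByName.lean`.

HONEST FRAMING: definitions + definitional bookkeeping over landed files; no instance, no notation, no `Prop` fact; typed ≠
inhabited ≠ proved; nothing here asserts that a bad-place group datum arises from an actual Tate curve, nothing bears on [IUTchIII]
Cor. 3.12, nothing asserts abc proved or refuted.
-/

noncomputable section

namespace Literature.IUT.HodgeTheaters

open Literature.AnabelianGeometry.AbsoluteAnabelian

/-! ### §1. `(K_v, K̄_v)` as an [AbsTopIII] Def 3.1 (i) closure datum -/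

namespace GaloisValDatum

variable (p : ℕ) [Fact p.Prime] (k : Type) [NontriviallyNormedField k] [IsUltrametricDist k] [NormedAlgebra ℚ_[p] k]
  [FiniteDimensional ℚ_[p] k]

/-- **`(k, k̄) = (K_v, K̄_v)` as abc-iut-L4-t2's `MLFClosure` datum** («Let `k` be an MLF, `k̄` an algebraic closure of `k`») for
ANY field `k` complete with respect to a nontrivial nonarchimedean norm and finite over `ℚ_p`: `k` with the valuative relation of its
norm (abc-iut-L5-t16's `GaloisValDatum.normVal`, the relation of `GaloisValDatum.ofComplete p k`), a non-archimedean local field by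
abc-iut-w4-d014's `isNonarchimedeanLocalField_of_finiteDimensional_padic`, of characteristic `0` (`GaloisValDatum.charZero`), and
`k̄ := AlgebraicClosure k` = the `Ω` of `GaloisValDatum.ofComplete p k`. [cite: MochizukiAbsTopIII2015, Definition 3.1 (i) p.66] -/
def closureOfComplete : MLFClosure.{0} :=
  letI : ValuativeRel k := GaloisValDatum.normVal k
  haveI : IsNonarchimedeanLocalField k :=
    Literature.NumberTheory.LocalFields.isNonarchimedeanLocalField_of_finiteDimensional_padic k p
  haveI : CharZero k := GaloisValDatum.charZero p k
  { k := k, K := AlgebraicClosure k }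

/-- Its MLF is `k = K_v`. [cite: MochizukiAbsTopIII2015, Definition 3.1 (i) p.66] -/
theorem closureOfComplete_k : (closureOfComplete p k).k = k := rfl

/-- Its algebraic closure is `K̄_v = AlgebraicClosure k` (= the `Ω` of `GaloisValDatum.ofComplete p k`, definitionally).
[cite: MochizukiAbsTopIII2015, Definition 3.1 (i) p.66] -/
theorem closureOfComplete_K : (closureOfComplete p k).K = AlgebraicClosure k := rfl

end GaloisValDatum

/-! ### §2. The bad-place group datum as [AbsTopIII] Def 3.1 (i) model data; the `TM`-pair `(Π_v ↷ 𝒪^▷_{K̄_v})` -/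

namespace BadLocalGroupDatum

variable {p : ℕ} [Fact p.Prime] {k : Type} [NontriviallyNormedField k] [CompleteSpace k] [IsUltrametricDist k]
  [NormedAlgebra ℚ_[p] k] [FiniteDimensional ℚ_[p] k]
  {P : Type} [Group P] [TopologicalSpace P] [IsTopologicalGroup P]
  (T : BadLocalGroupDatum (GaloisValDatum.ofComplete p k).Gal P)

/-- **The bad-place group datum `Π_v ↠ G_v` IS [AbsTopIII] Def 3.1 (i) model data** («Let `Π_k` be a topological group, equipped with a
continuous surjection `ε_k : Π_k ↠ G_k`»): `Π_k := Π_v`, `ε_k := aug` ([IUTchI] Ex 3.2 (i) «a natural functor `𝒟_v → 𝒟⊢_v`»),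
continuity = the datum's `continuous_aug`, surjectivity = abc-iut-L5-t2's `surjective_aug` («the base field of `Ÿ_v` is equal to
`K_v`»). ([IUTchI] Ex 3.2 (i) p.70) [claim: Mochizuki2012, status: disputed] -/
def modelData : ModelMLFGaloisData (GaloisValDatum.closureOfComplete p k).k (GaloisValDatum.closureOfComplete p k).K where
  Pi := P
  aug := T.aug
  continuous_aug := T.continuous_aug
  aug_surjective := T.surjective_aug

/-- The group of the model data is `Π_v`. ([IUTchI] Ex 3.2 (i) p.70) [claim: Mochizuki2012, status: disputed] -/
theorem modelData_Pi : T.modelData.Pi = P := rfl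

/-- The augmentation of the model data is `aug : Π_v ↠ G_v`. ([IUTchI] Ex 3.2 (i) p.70) [claim: Mochizuki2012, status: disputed] -/
theorem modelData_aug : T.modelData.aug = T.aug := rfl

/-- **The MLF-Galois `TM`-pair `(Π_v̲ ↷ 𝒪^▷_{K̄_v̲})` of a bad-place group datum** — [IUTchI] Def 5.2 (v)/(vi) «an ind-topological monoid
[which is naturally isomorphic to `𝒪^▷_{F̄_v̲}`] `𝕄_v(‡𝒟_v̲)` equipped with its natural `π₁(‡𝒟_v)`-action» / «the `p_v̲`-adic Frobenioid
determined … by the pair `π₁(‡𝒟_v̲) ↷ ‡𝕄_v`» at `v̲ ∈ V̲^bad`, here with `π₁(‡𝒟_v̲) = Π_v` acting on `𝒪^▷_{K̄_v} ⊆ K̄_v` (the non-zero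
integers of the algebraic closure, abc-iut-L4-t2's `nonzeroIntegers`) through `aug : Π_v ↠ Gal(K̄_v/K_v)`: abc-iut-L4-t2's model
`TM`-pair `ModelMLFGaloisData.tmPair` of `T.modelData`, NOTHING restated. ([IUTchI] Def 5.2 (v) p.135) [claim: Mochizuki2012, status: disputed] -/
abbrev tmPair : GaloisMonoidPair.{0} := T.modelData.tmPair

/-- The group of the pair is `Π_v`. ([IUTchI] Def 5.2 (v) p.135) [claim: Mochizuki2012, status: disputed] -/
theorem tmPair_Pi : T.tmPair.Pi = P := rfl

/-- The action of the pair, on underlying elements of `K̄_v`: `g • x = aug(g)(x)`. ([IUTchI] Def 5.2 (v) p.135) [claim: Mochizuki2012, status: disputed] -/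
theorem tmPair_coe_smul (g : T.tmPair.Pi) (x : T.tmPair.M) :
    ((g • x : T.tmPair.M) : (GaloisValDatum.closureOfComplete p k).K) =
      T.modelData.aug g • (x : (GaloisValDatum.closureOfComplete p k).K) := rfl

end BadLocalGroupDatum

end Literature.IUT.HodgeTheaters

end
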